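import Summits.AtomisticToContinuum.HydrodynamicLimit.Theorems.RelayRaceLocalityConeLocalisationBubbleAssemblyA
import Literature.MathematicalPhysics.KineticTheory.HardSphereEulerSolutionGluing
import Literature.MathematicalPhysics.KineticTheory.HardSphereEulerLevelEnergies
import Literature.MathematicalPhysics.KineticTheory.HardSphereEulerEnergyShell
import HarnessLib

/-!
# RelayRaceLocality · ConeLocalisation — bubble stub, helper (AP) part B: the improvement step of the bootstrap

Helper file (part B of three) for the lead-held stub `stub_bubble : BubbleAtScale` of line `Sketch`
(zoomed-bubble-transplant) of the crux item `stmt-AtomisticToContinuum-12504` (`ConeLocalisation`), lead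
prover-line-stmt-AtomisticToContinuum-12504-0 (2026-08-17). Contents: the two-quantity continuity principle
(`HsEulerCalc.bootstrap_of_continuousOn` at `ι = Bool`); the `C⁰` and `C¹` ENVELOPES of a classical solution (sums of
the sup norms of the deviations from a constant state and of the nine first derivatives: continuous in time, dominating,
minimal — `HsEulerStability.shadow_sup_continuous`); support along the bootstrap (input (D)); and the DERIVATIVE
IMPROVEMENT `ap_deriv_improve`: restrict to `[0, t)`, zoom by `m = 1/(10r)` (input (Z)), homogeneous energy inequality at
unit scale (input (H)), zoomed data energy `≤ 81270900 (κr)²` (part A), read-out (input (T)) and un-zoom, giving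
`|∂V| ≤ √(K_S C_H 81270900) κ / 10` on `[0, t)`. The a-priori estimate and the assembly follow in `…BubbleAssembly.lean`.
-/

noncomputable section

namespace Summit.AtomisticToContinuum.HydrodynamicLimit.Theorems.ConeLocalisation.Bubble

open Set MeasureTheory
open scoped ENNReal
open Literature.MathematicalPhysics.KineticTheory Literature.Analysis.FluidPDE
  Literature.Analysis.FunctionSpaces
open Summit.AtomisticToContinuum.HydrodynamicLimit.Theorems.ConeLocalisation

/-! ## The continuity principle with two quantities -/

/-- **Two-quantity continuity (bootstrap) principle** on `[0, T)`: the case `ι = Bool` of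
`HsEulerCalc.bootstrap_of_continuousOn` with constant positive thresholds. -/
theorem ap_bootstrap_two {T : ℝ} {g₁ g₂ : ℝ → ℝ} {b₁ b₂ : ℝ}
    (hg₁ : ContinuousOn g₁ (Ico 0 T)) (hg₂ : ContinuousOn g₂ (Ico 0 T))
    (hb₁ : 0 < b₁) (hb₂ : 0 < b₂) (h0₁ : g₁ 0 ≤ b₁) (h0₂ : g₂ 0 ≤ b₂)
    (himp : ∀ t ∈ Ico 0 T, (∀ s ∈ Icc 0 t, g₁ s ≤ 2 * b₁ ∧ g₂ s ≤ 2 * b₂) →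
      g₁ t ≤ b₁ ∧ g₂ t ≤ b₂) :
    ∀ t ∈ Ico 0 T, g₁ t ≤ b₁ ∧ g₂ t ≤ b₂ := by
  have key := HsEulerCalc.bootstrap_of_continuousOn (ι := Bool) (T := T)
    (g := fun j => cond j g₁ g₂) (b := fun j _ => cond j b₁ b₂)
    (fun j => by cases j; exacts [hg₂, hg₁])
    (fun j => by cases j; exacts [continuousOn_const, continuousOn_const])
    (fun j _ _ => by cases j; exacts [hb₂, hb₁])
    (fun j => by cases j; exacts [h0₂, h0₁])
    (fun t ht hw => by
      have h := himp t ht fun s hs => ⟨hw true s hs, hw false s hs⟩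
      intro j; cases j; exacts [h.2, h.1])
  exact fun t ht => ⟨key true t ht, key false t ht⟩

/-! ## The two envelopes (sums of sup norms, stated existentially) -/

/-- **The `C⁰` envelope of a classical solution** (the sum of the sup norms of the deviations `ρ - ρ̄`, `θ - θ̄`,
`u - ū`): a function `E` continuous on `[0, T)`, dominating the three deviations pointwise, and `≤ 3K` at any time at
which each deviation is `≤ K` everywhere. -/
theorem ap_env0_spec {σ T : ℝ} {ρ θ : ℝ → T3 → ℝ} {u : ℝ → T3 → V3}
    (h : IsHardSphereEulerSolution σ T ρ u θ) (ρbar θbar : ℝ) (ubar : V3) :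
    ∃ E : ℝ → ℝ, ContinuousOn E (Ico 0 T) ∧
    (∀ s ∈ Ico 0 T, ∀ x, |ρ s x - ρbar| ≤ E s ∧ |θ s x - θbar| ≤ E s ∧ ‖u s x - ubar‖ ≤ E s) ∧
    (∀ (s K : ℝ), 0 ≤ K → (∀ x, |ρ s x - ρbar| ≤ K ∧ |θ s x - θbar| ≤ K ∧ ‖u s x - ubar‖ ≤ K) → E s ≤ 3 * K) := by
  have hφ₁ : Torus.IsSmoothSpaceTimeOn (Ico 0 T) (fun t x => ρ t x - ρbar) :=
    h.smooth_density.sub (Torus.isSmoothSpaceTimeOn_const (Torus.isSmooth_const ρbar) _)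
  have hφ₂ : Torus.IsSmoothSpaceTimeOn (Ico 0 T) (fun t x => θ t x - θbar) :=
    h.smooth_temperature.sub (Torus.isSmoothSpaceTimeOn_const (Torus.isSmooth_const θbar) _)
  have hφ₃ : Torus.IsSmoothSpaceTimeOn (Ico 0 T) (fun t x => u t x - ubar) :=
    h.smooth_velocity.sub (Torus.isSmoothSpaceTimeOn_const (Torus.isSmooth_const ubar) _)
  obtain ⟨c₁, d₁, m₁⟩ := HsEulerStability.shadow_sup_continuous hφ₁
  obtain ⟨c₂, d₂, m₂⟩ := HsEulerStability.shadow_sup_continuous hφ₂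
  obtain ⟨c₃, d₃, m₃⟩ := HsEulerStability.shadow_sup_continuous_vec hφ₃
  refine ⟨fun s => (eSupNorm (fun x => ρ s x - ρbar)).toReal + (eSupNorm (fun x => θ s x - θbar)).toReal +
    (eSupNorm (fun x => u s x - ubar)).toReal, (c₁.add c₂).add c₃, fun s hs x => ?_, fun s K hK hb => ?_⟩
  · have e₁ := d₁ s hs x
    have e₂ := d₂ s hs x
    have e₃ := d₃ s hs x
    have n₁ : 0 ≤ (eSupNorm (fun x => ρ s x - ρbar)).toReal := ENNReal.toReal_nonneg
    have n₂ : 0 ≤ (eSupNorm (fun x => θ s x - θbar)).toReal := ENNReal.toReal_nonneg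
    have n₃ : 0 ≤ (eSupNorm (fun x => u s x - ubar)).toReal := ENNReal.toReal_nonneg
    beta_reduce
    exact ⟨by linarith, by linarith, by linarith⟩
  · beta_reduce
    have f₁ := m₁ s K hK fun x => (hb x).1
    have f₂ := m₂ s K hK fun x => (hb x).2.1
    have f₃ := m₃ s K hK fun x => (hb x).2.2
    linarith

/-- **The `C¹` envelope of a classical solution** (the sum of the nine sup norms of the first derivatives): a function
`E` continuous on `[0, T)`, dominating the nine first derivatives pointwise, and `≤ 9K` at any time at which each of
them is `≤ K` everywhere. -/
theorem ap_env1_spec {σ T : ℝ} {ρ θ : ℝ → T3 → ℝ} {u : ℝ → T3 → V3}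
    (h : IsHardSphereEulerSolution σ T ρ u θ) :
    ∃ E : ℝ → ℝ, ContinuousOn E (Ico 0 T) ∧
    (∀ s ∈ Ico 0 T, ∀ x (i : Fin 3), |Torus.partialDeriv i (ρ s) x| ≤ E s ∧
      ‖Torus.partialDeriv i (u s) x‖ ≤ E s ∧ |Torus.partialDeriv i (θ s) x| ≤ E s) ∧
    (∀ (s K : ℝ), 0 ≤ K → (∀ x (i : Fin 3), |Torus.partialDeriv i (ρ s) x| ≤ K ∧
      ‖Torus.partialDeriv i (u s) x‖ ≤ K ∧ |Torus.partialDeriv i (θ s) x| ≤ K) → E s ≤ 9 * K) := by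
  have hU : UniqueDiffOn ℝ (Ico (0 : ℝ) T) := uniqueDiffOn_Ico 0 T
  have H₁ := fun i : Fin 3 => HsEulerStability.shadow_sup_continuous (h.smooth_density.partialDeriv hU i)
  have H₂ := fun i : Fin 3 => HsEulerStability.shadow_sup_continuous_vec (h.smooth_velocity.partialDeriv hU i)
  have H₃ := fun i : Fin 3 => HsEulerStability.shadow_sup_continuous (h.smooth_temperature.partialDeriv hU i)
  -- the summand of index `i`
  set F : Fin 3 → ℝ → ℝ := fun i s => (eSupNorm (Torus.partialDeriv i (ρ s))).toReal +
    (eSupNorm (Torus.partialDeriv i (u s))).toReal + (eSupNorm (Torus.partialDeriv i (θ s))).toReal with hF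
  have hFnn : ∀ i s, 0 ≤ F i s := fun i s =>
    add_nonneg (add_nonneg ENNReal.toReal_nonneg ENNReal.toReal_nonneg) ENNReal.toReal_nonneg
  refine ⟨fun s => ∑ i : Fin 3, F i s, ?_, fun s hs x i => ?_, fun s K hK hb => ?_⟩
  · have hc : ∀ i : Fin 3, ContinuousOn (F i) (Ico 0 T) := fun i => ((H₁ i).1.add (H₂ i).1).add (H₃ i).1
    exact continuousOn_finsetSum (Finset.univ : Finset (Fin 3)) fun i _ => hc i
  · have e₁ := (H₁ i).2.1 s hs x
    have e₂ := (H₂ i).2.1 s hs x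
    have e₃ := (H₃ i).2.1 s hs x
    have n₁ : 0 ≤ (eSupNorm (Torus.partialDeriv i (ρ s))).toReal := ENNReal.toReal_nonneg
    have n₂ : 0 ≤ (eSupNorm (Torus.partialDeriv i (u s))).toReal := ENNReal.toReal_nonneg
    have n₃ : 0 ≤ (eSupNorm (Torus.partialDeriv i (θ s))).toReal := ENNReal.toReal_nonneg
    have hle : F i s ≤ ∑ j : Fin 3, F j s :=
      Finset.single_le_sum (f := fun j => F j s) (fun j _ => hFnn j s) (Finset.mem_univ i)
    have hFi : F i s = (eSupNorm (Torus.partialDeriv i (ρ s))).toReal +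
      (eSupNorm (Torus.partialDeriv i (u s))).toReal + (eSupNorm (Torus.partialDeriv i (θ s))).toReal := rfl
    beta_reduce
    exact ⟨by linarith, by linarith, by linarith⟩
  · beta_reduce
    have hle : ∀ i : Fin 3, F i s ≤ 3 * K := fun i => by
      have f₁ := (H₁ i).2.2 s K hK fun x => (hb x i).1
      have f₂ := (H₂ i).2.2 s K hK fun x => (hb x i).2.1
      have f₃ := (H₃ i).2.2 s K hK fun x => (hb x i).2.2
      have hFi : F i s = (eSupNorm (Torus.partialDeriv i (ρ s))).toReal +
        (eSupNorm (Torus.partialDeriv i (u s))).toReal + (eSupNorm (Torus.partialDeriv i (θ s))).toReal := rfl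
      linarith
    calc ∑ i : Fin 3, F i s ≤ ∑ _i : Fin 3, 3 * K := Finset.sum_le_sum fun i _ => hle i
      _ = 9 * K := by
        simp only [Finset.sum_const, Finset.card_univ, Fintype.card_fin, nsmul_eq_mul, Nat.cast_ofNat]
        ring

/-! ## Support and derivative improvement along the bootstrap -/

/-- **Support along the bootstrap** (finite speed of propagation against the constant state, input (D) at level
`M + 1`): with weak `C⁰` bounds `≤ δ ≤ 1/(4M)` on `[0, t]` round the guarded constant state and data equal to it off
`B(x₀, 2r)`, the solution equals the constant state at time `t` off `B(x₀, 2r + c_D t)`. -/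
theorem ap_support {ηD cD M σ ρbar θbar P r δ T₀ t : ℝ} {ubar : V3} {x₀ : T3} {ρ θ : ℝ → T3 → ℝ}
    {u : ℝ → T3 → V3}
    (hDm : ∀ σ : ℝ, 0 < σ → ∀ (T : ℝ) (ρ θ : ℝ → T3 → ℝ) (u : ℝ → T3 → V3),
        IsHardSphereEulerSolution σ T ρ u θ →
      ∀ (ρbar θbar : ℝ) (ubar : V3), 0 < ρbar → 0 < θbar → ρbar * σ ^ 3 < ηD → θbar ≤ M + 1 →
        ‖ubar‖ ≤ M + 1 →
      ∀ t : ℝ, 0 ≤ t → t < T →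
        (∀ s ∈ Set.Icc 0 t, ∀ x, ρ s x * σ ^ 3 < ηD ∧ θ s x ≤ M + 1 ∧ ‖u s x‖ ≤ M + 1) →
      ∀ (x₀ : T3) (a : ℝ),
        (∀ x, a ≤ Torus.euclidDist x x₀ → ρ 0 x = ρbar ∧ u 0 x = ubar ∧ θ 0 x = θbar) →
      ∀ x, a + cD * t < Torus.euclidDist x x₀ → ρ t x = ρbar ∧ u t x = ubar ∧ θ t x = θbar)
    (hM : 1 ≤ M) (hσ : 0 < σ) (h1 : M⁻¹ ≤ ρbar) (h2 : ρbar ≤ M) (h3 : M⁻¹ ≤ θbar) (h4 : θbar ≤ M)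
    (h5 : ‖ubar‖ ≤ M) (hP : (ρbar + 1 / (4 * M)) * σ ^ 3 ≤ P) (hPD : P < ηD)
    (hsol : IsHardSphereEulerSolution σ T₀ ρ u θ)
    (hsupp : ∀ x, 2 * r ≤ Torus.euclidDist x x₀ → ρ 0 x = ρbar ∧ θ 0 x = θbar ∧ u 0 x = ubar)
    (ht : t ∈ Ico 0 T₀) (hδ : δ ≤ 1 / (4 * M))
    (hw : ∀ s ∈ Icc 0 t, ∀ x, |ρ s x - ρbar| ≤ δ ∧ |θ s x - θbar| ≤ δ ∧ ‖u s x - ubar‖ ≤ δ) :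
    ∀ x, 2 * r + cD * t < Torus.euclidDist x x₀ → ρ t x = ρbar ∧ θ t x = θbar ∧ u t x = ubar := by
  have hM0 : 0 < M := by linarith
  have hσ3 : 0 < σ ^ 3 := pow_pos hσ 3
  have hρbar : 0 < ρbar := (inv_pos.2 hM0).trans_le h1
  have hθbar : 0 < θbar := (inv_pos.2 hM0).trans_le h3
  have hpk : ρbar * σ ^ 3 < ηD := by
    have : ρbar ≤ ρbar + 1 / (4 * M) := by simp only [le_add_iff_nonneg_right]; positivity
    exact ((mul_le_mul_of_nonneg_right this hσ3.le).trans hP).trans_lt hPD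
  have hg : ∀ s ∈ Set.Icc 0 t, ∀ x, ρ s x * σ ^ 3 < ηD ∧ θ s x ≤ M + 1 ∧ ‖u s x‖ ≤ M + 1 := by
    intro s hs x
    obtain ⟨a1, a2, a3⟩ := hw s hs x
    obtain ⟨-, -, -, -, -, b6, b7, b8, -, -⟩ := ap_state hM h1 h2 h3 h4 h5 hδ a1 a2 a3
    exact ⟨((mul_le_mul_of_nonneg_right b8 hσ3.le).trans hP).trans_lt hPD, b6, b7⟩
  intro x hx
  obtain ⟨e1, e2, e3⟩ := hDm σ hσ T₀ ρ θ u hsol ρbar θbar ubar hρbar hθbar hpk (by linarith) (by linarith)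
    t ht.1 ht.2 hg x₀ (2 * r) (fun y hy => ⟨(hsupp y hy).1, (hsupp y hy).2.2, (hsupp y hy).2.1⟩) x hx
  exact ⟨e1, e3, e2⟩

/-- **Derivative improvement** (the heart of the bootstrap). At a time `t > 0` with weak bounds `|V - V̄| ≤ δ ≤ 1/(4M)`,
`|∂V| ≤ A` (`10 r A ≤ 1`) on `[0, t]` and support in `B(x₀, 2r + c_D s)` at every `s < t`: restrict the solution to
`[0, t)`, zoom by `m = 1/(10 r)` round `x₀` (input (Z), radius `a = 9r/4`), apply the homogeneous energy inequality at
unit scale (input (H), box `1/(4M)`, derivatives `≤ 10 r A ≤ 1`), bound the zoomed data energy by `81270900 (κr)²`,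
read the zoomed first derivatives out of the energy (input (T), `≤ C₂ κ r`, `C₂ = √(K_S C_H 81270900)`), and un-zoom
(`× m`): `|∂V(s, x)| ≤ C₂ κ / 10` for all `s ∈ [0, t)` — inside `B(x₀, 5r)` by the surjectivity of the zoom map, outside
by locality. -/
theorem ap_deriv_improve :
    ∀ {ηH ηZ KS CH cD M σ ρbar θbar P r κ δ A T₀ t m a : ℝ} {ubar : V3} {x₀ : T3} {Z : T3 → T3} {ρ θ : ℝ → T3 → ℝ}
      {u : ℝ → T3 → V3},
    (∀ f : T3 → ℝ, Torus.IsSmooth f → ∀ (x : T3) (l : Fin 3), Torus.partialDeriv l f x ^ 2 ≤ KS * fieldD3 f) →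
    (∀ w : T3 → V3, Torus.IsSmooth w → ∀ (x : T3) (l : Fin 3), ‖Torus.partialDeriv l w x‖ ^ 2 ≤ KS * fieldD3V w) →
    (∀ σ : ℝ, 0 < σ → ∀ (ρbar θbar : ℝ) (ubar : V3), M⁻¹ ≤ ρbar → ρbar ≤ M → M⁻¹ ≤ θbar → θbar ≤ M → ‖ubar‖ ≤ M →
      ρbar * σ ^ 3 ≤ ηH → ∀ T : ℝ, 0 < T → T ≤ 1 → ∀ (ρ θ : ℝ → T3 → ℝ) (u : ℝ → T3 → V3), IsHardSphereEulerSolution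
      σ T ρ u θ → (∀ t ∈ Ico 0 T, ∀ x, |ρ t x - ρbar| ≤ 1 / (4 * M) ∧ |θ t x - θbar| ≤ 1 / (4 * M) ∧ ‖u t x - ubar‖
      ≤ 1 / (4 * M) ∧ ∀ i : Fin 3, |Torus.partialDeriv i (ρ t) x| ≤ 1 ∧ ‖Torus.partialDeriv i (u t) x‖ ≤ 1 ∧
      |Torus.partialDeriv i (θ t) x| ≤ 1) → ∀ t ∈ Ico 0 T, D3 ρ u θ t ≤ CH * D3 ρ u θ 0) →
    (∀ x, Torus.euclidDist x x₀ < 1 / (2 * m) → ∃ y, Z y = x) →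
    (∀ (g : T3 → ℝ) (c : ℝ), Torus.IsSmooth g → (∀ x, a ≤ Torus.euclidDist x x₀ → g x = c) → Torus.IsSmooth (fun y
      => g (Z y)) ∧ (∀ y (i : Fin 3), Torus.partialDeriv i (fun y => g (Z y)) y = m⁻¹ * Torus.partialDeriv i g (Z
      y)) ∧ (∀ y, m * a ≤ Torus.euclidDist y x₀ → g (Z y) = c)) →
    (∀ (w : T3 → V3) (c : V3), Torus.IsSmooth w → (∀ x, a ≤ Torus.euclidDist x x₀ → w x = c) → Torus.IsSmooth (fun y
      => w (Z y)) ∧ (∀ y (i : Fin 3), Torus.partialDeriv i (fun y => w (Z y)) y = m⁻¹ • Torus.partialDeriv i w (Z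
      y)) ∧ (∀ y, m * a ≤ Torus.euclidDist y x₀ → w (Z y) = c)) →
    (∀ (σ T : ℝ) (ρ θ : ℝ → T3 → ℝ) (u : ℝ → T3 → V3), IsHardSphereEulerSolution σ T ρ u θ → ∀ (ρbar θbar : ℝ) (ubar
      : V3), (∀ t ∈ Ico 0 T, ∀ x, a ≤ Torus.euclidDist x x₀ → ρ t x = ρbar ∧ θ t x = θbar ∧ u t x = ubar) → (∀ t ∈
      Ico 0 T, ∀ x, ρ t x * σ ^ 3 ≤ ηZ) → IsHardSphereEulerSolution σ (m * T) (fun s y => ρ (s / m) (Z y)) (fun s y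
      => u (s / m) (Z y)) (fun s y => θ (s / m) (Z y))) →
    (0 ≤ KS) → (0 ≤ CH) → (1 ≤ M) → (0 < σ) → (M⁻¹ ≤ ρbar) → (ρbar ≤ M) → (M⁻¹ ≤ θbar) → (θbar ≤ M) → (‖ubar‖ ≤ M) →
    ((ρbar + 1 / (4 * M)) * σ ^ 3 ≤ P) → (P ≤ ηZ) → (ρbar * σ ^ 3 ≤ ηH) → (0 < r) → (0 ≤ κ) → (m = (10 * r)⁻¹) →
    (a = 9 / 4 * r) → (δ ≤ 1 / (4 * M)) → (10 * r * A ≤ 1) → (cD * t < r / 4) → (0 ≤ cD) → (t ≤ 10 * r) →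
    (IsHardSphereEulerSolution σ T₀ ρ u θ) → (t ∈ Ico 0 T₀) → (0 < t) →
    (∀ x, 2 * r ≤ Torus.euclidDist x x₀ → ρ 0 x = ρbar ∧ θ 0 x = θbar ∧ u 0 x = ubar) →
    (ScaleDeviation (ρ 0) ρbar r κ) → (ScaleDeviation (θ 0) θbar r κ) → (ScaleDeviationV (u 0) ubar r κ) →
    (∀ s ∈ Icc 0 t, ∀ x, |ρ s x - ρbar| ≤ δ ∧ |θ s x - θbar| ≤ δ ∧ ‖u s x - ubar‖ ≤ δ ∧ ∀ i : Fin 3,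
      |Torus.partialDeriv i (ρ s) x| ≤ A ∧ ‖Torus.partialDeriv i (u s) x‖ ≤ A ∧ |Torus.partialDeriv i (θ s) x| ≤ A)
      →
    (∀ s ∈ Ico 0 t, ∀ x, 2 * r + cD * s < Torus.euclidDist x x₀ → ρ s x = ρbar ∧ θ s x = θbar ∧ u s x = ubar) →
    ∀ s ∈ Ico 0 t, ∀ x (i : Fin 3), |Torus.partialDeriv i (ρ s) x| ≤ Real.sqrt (KS * CH * 81270900) * κ / 10 ∧
      ‖Torus.partialDeriv i (u s) x‖ ≤ Real.sqrt (KS * CH * 81270900) * κ / 10 ∧ |Torus.partialDeriv i (θ s) x| ≤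
      Real.sqrt (KS * CH * 81270900) * κ / 10 := by
  intro ηH ηZ KS CH cD M σ ρbar θbar P r κ δ A T₀ t m a ubar x₀ Z ρ θ u hS₁ hS₂ hHm hZsurj hZs hZv hZsol hKS
    hCH hM hσ h1 h2 h3 h4 h5 hP hPZ hHη hr hκ hm ha hδ hA hcDt hcD ht10 hsol ht ht0 hsupp hSρ hSθ hSu hw hfar
  -- constants
  have h10r : 0 < 10 * r := by positivity
  have hm0 : 0 < m := by rw [hm]; positivity
  have hminv : m⁻¹ = 10 * r := by rw [hm, inv_inv]
  have h2m : 1 / (2 * m) = 5 * r := by rw [hm]; field_simp; ring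
  have hM0 : 0 < M := by linarith
  have hσ3 : 0 < σ ^ 3 := pow_pos hσ 3
  set C₂ : ℝ := Real.sqrt (KS * CH * 81270900) with hC₂
  have hC₂0 : 0 ≤ C₂ := Real.sqrt_nonneg _
  have hC₂sq : C₂ ^ 2 = KS * CH * 81270900 := Real.sq_sqrt (by positivity)
  -- (i) restriction to `[0, t)` and the support there
  have hsolt : IsHardSphereEulerSolution σ t ρ u θ := hsol.restrict ht.2.le
  have hfar' : ∀ s ∈ Ico 0 t, ∀ x, a ≤ Torus.euclidDist x x₀ →
      ρ s x = ρbar ∧ θ s x = θbar ∧ u s x = ubar := by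
    intro s hs x hx
    refine hfar s hs x ?_
    have : cD * s ≤ cD * t := mul_le_mul_of_nonneg_left hs.2.le hcD
    rw [ha] at hx
    linarith
  -- (ii) packing on `[0, t)`
  have hpk : ∀ s ∈ Ico 0 t, ∀ x, ρ s x * σ ^ 3 ≤ ηZ := by
    intro s hs x
    obtain ⟨a1, a2, a3, -⟩ := hw s (Ico_subset_Icc_self hs) x
    have b8 := (ap_state hM h1 h2 h3 h4 h5 hδ a1 a2 a3).2.2.2.2.2.2.2.1
    exact ((mul_le_mul_of_nonneg_right b8 hσ3.le).trans hP).trans hPZ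
  -- (iii) the zoomed solution on `[0, m t)`
  have hZS := hZsol σ t ρ θ u hsolt ρbar θbar ubar hfar' hpk
  have hconv : ∀ τ ∈ Ico 0 (m * t), τ / m ∈ Ico 0 t := by
    intro τ hτ
    refine ⟨div_nonneg hτ.1 hm0.le, ?_⟩
    rw [div_lt_iff₀ hm0]
    linarith [hτ.2, mul_comm m t]
  have hsl : ∀ s ∈ Ico 0 t, Torus.IsSmooth (ρ s) ∧ Torus.IsSmooth (u s) ∧ Torus.IsSmooth (θ s) :=
    fun s hs => hsol.isSmooth_slices ⟨hs.1, hs.2.trans ht.2⟩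
  -- (iv) first derivatives of the zoomed slices
  have hDρ : ∀ s ∈ Ico 0 t, ∀ y (i : Fin 3), Torus.partialDeriv i (fun y => ρ s (Z y)) y =
      m⁻¹ * Torus.partialDeriv i (ρ s) (Z y) :=
    fun s hs => (hZs (ρ s) ρbar (hsl s hs).1 fun x hx => (hfar' s hs x hx).1).2.1
  have hDθ : ∀ s ∈ Ico 0 t, ∀ y (i : Fin 3), Torus.partialDeriv i (fun y => θ s (Z y)) y =
      m⁻¹ * Torus.partialDeriv i (θ s) (Z y) :=
    fun s hs => (hZs (θ s) θbar (hsl s hs).2.2 fun x hx => (hfar' s hs x hx).2.1).2.1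
  have hDu : ∀ s ∈ Ico 0 t, ∀ y (i : Fin 3), Torus.partialDeriv i (fun y => u s (Z y)) y =
      m⁻¹ • Torus.partialDeriv i (u s) (Z y) :=
    fun s hs => (hZv (u s) ubar (hsl s hs).2.1 fun x hx => (hfar' s hs x hx).2.2).2.1
  -- (v) the box hypothesis of the energy inequality for the zoomed solution
  have hbox : ∀ τ ∈ Ico 0 (m * t), ∀ y,
      |ρ (τ / m) (Z y) - ρbar| ≤ 1 / (4 * M) ∧ |θ (τ / m) (Z y) - θbar| ≤ 1 / (4 * M) ∧
      ‖u (τ / m) (Z y) - ubar‖ ≤ 1 / (4 * M) ∧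
      ∀ i : Fin 3, |Torus.partialDeriv i (fun y => ρ (τ / m) (Z y)) y| ≤ 1 ∧
        ‖Torus.partialDeriv i (fun y => u (τ / m) (Z y)) y‖ ≤ 1 ∧
        |Torus.partialDeriv i (fun y => θ (τ / m) (Z y)) y| ≤ 1 := by
    intro τ hτ y
    have hs := hconv τ hτ
    obtain ⟨a1, a2, a3, a4⟩ := hw (τ / m) (Ico_subset_Icc_self hs) (Z y)
    refine ⟨a1.trans hδ, a2.trans hδ, a3.trans hδ, fun i => ?_⟩
    obtain ⟨d1, d2, d3⟩ := a4 i
    refine ⟨?_, ?_, ?_⟩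
    · rw [hDρ _ hs y i, abs_mul, hminv, abs_of_pos h10r]
      calc 10 * r * |Torus.partialDeriv i (ρ (τ / m)) (Z y)| ≤ 10 * r * A := by gcongr
        _ ≤ 1 := hA
    · rw [hDu _ hs y i, norm_smul, hminv, Real.norm_of_nonneg h10r.le]
      calc 10 * r * ‖Torus.partialDeriv i (u (τ / m)) (Z y)‖ ≤ 10 * r * A := by gcongr
        _ ≤ 1 := hA
    · rw [hDθ _ hs y i, abs_mul, hminv, abs_of_pos h10r]
      calc 10 * r * |Torus.partialDeriv i (θ (τ / m)) (Z y)| ≤ 10 * r * A := by gcongr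
        _ ≤ 1 := hA
  -- (vi) the energy inequality at unit scale
  have hmt0 : 0 < m * t := mul_pos hm0 ht0
  have hmt1 : m * t ≤ 1 := by
    rw [hm, inv_mul_le_iff₀ h10r]
    linarith
  have hEn := hHm σ hσ ρbar θbar ubar h1 h2 h3 h4 h5 hHη (m * t) hmt0 hmt1 _ _ _ hZS hbox
  -- (vii) the zoomed data energy (part A)
  have h0t : (0 : ℝ) ∈ Ico 0 t := ⟨le_rfl, ht0⟩
  have h2a : 2 * r < a := by rw [ha]; linarith
  have hD30 : D3 (fun s y => ρ (s / m) (Z y)) (fun s y => u (s / m) (Z y)) (fun s y => θ (s / m) (Z y)) 0 ≤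
      81270900 * (κ * r) ^ 2 := by
    have e : D3 (fun s y => ρ (s / m) (Z y)) (fun s y => u (s / m) (Z y)) (fun s y => θ (s / m) (Z y)) 0 =
        fieldD3 (fun y => ρ 0 (Z y)) + fieldD3V (fun y => u 0 (Z y)) + fieldD3 (fun y => θ 0 (Z y)) := by
      simp only [D3, zero_div]
    rw [e]
    obtain ⟨s1, s2, s3⟩ := hsl 0 h0t
    exact ap_D3_zoom_le hZs hZv s1 s3 s2 hsupp hSρ hSθ hSu hminv hr h2a
  -- (viii) read-out of the zoomed first derivatives
  have hread : ∀ τ ∈ Ico 0 (m * t), ∀ y (i : Fin 3),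
      |Torus.partialDeriv i (fun y => ρ (τ / m) (Z y)) y| ≤ C₂ * (κ * r) ∧
      ‖Torus.partialDeriv i (fun y => u (τ / m) (Z y)) y‖ ≤ C₂ * (κ * r) ∧
      |Torus.partialDeriv i (fun y => θ (τ / m) (Z y)) y| ≤ C₂ * (κ * r) := by
    intro τ hτ y i
    have hE : fieldD3 (fun y => ρ (τ / m) (Z y)) + fieldD3V (fun y => u (τ / m) (Z y)) +
        fieldD3 (fun y => θ (τ / m) (Z y)) ≤ CH * (81270900 * (κ * r) ^ 2) :=
      (hEn τ hτ).trans (mul_le_mul_of_nonneg_left hD30 hCH)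
    obtain ⟨z1, z2, z3⟩ := hZS.isSmooth_slices hτ
    have q1 : Torus.partialDeriv i (fun y => ρ (τ / m) (Z y)) y ^ 2 ≤ KS * fieldD3 (fun y => ρ (τ / m) (Z y)) :=
      hS₁ _ z1 y i
    have q2 : ‖Torus.partialDeriv i (fun y => u (τ / m) (Z y)) y‖ ^ 2 ≤ KS * fieldD3V (fun y => u (τ / m) (Z y)) :=
      hS₂ _ z2 y i
    have q3 : Torus.partialDeriv i (fun y => θ (τ / m) (Z y)) y ^ 2 ≤ KS * fieldD3 (fun y => θ (τ / m) (Z y)) :=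
      hS₁ _ z3 y i
    have n1 := fieldD3_nonneg (fun y => ρ (τ / m) (Z y))
    have n2 := fieldD3V_nonneg (fun y => u (τ / m) (Z y))
    have n3 := fieldD3_nonneg (fun y => θ (τ / m) (Z y))
    have hb : 0 ≤ C₂ * (κ * r) := by positivity
    have hsq : (C₂ * (κ * r)) ^ 2 = KS * (CH * (81270900 * (κ * r) ^ 2)) := by rw [mul_pow, hC₂sq]; ring
    refine ⟨abs_le_of_sq_le_sq ?_ hb, ?_, abs_le_of_sq_le_sq ?_ hb⟩
    · rw [hsq]
      exact q1.trans (mul_le_mul_of_nonneg_left (by linarith) hKS)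
    · have h' : ‖Torus.partialDeriv i (fun y => u (τ / m) (Z y)) y‖ ^ 2 ≤ (C₂ * (κ * r)) ^ 2 := by
        rw [hsq]
        exact q2.trans (mul_le_mul_of_nonneg_left (by linarith) hKS)
      have := abs_le_of_sq_le_sq h' hb
      rwa [abs_norm] at this
    · rw [hsq]
      exact q3.trans (mul_le_mul_of_nonneg_left (by linarith) hKS)
  -- (ix) un-zoom
  intro s hs x i
  have hb : 0 ≤ C₂ * κ / 10 := by positivity
  by_cases hx : Torus.euclidDist x x₀ < 5 * r
  · obtain ⟨y, rfl⟩ := hZsurj x (by rwa [h2m])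
    have hms : m * s ∈ Ico 0 (m * t) := ⟨mul_nonneg hm0.le hs.1, mul_lt_mul_of_pos_left hs.2 hm0⟩
    have R := hread (m * s) hms y i
    rw [mul_div_cancel_left₀ s hm0.ne'] at R
    obtain ⟨R1, R2, R3⟩ := R
    have E1 : Torus.partialDeriv i (ρ s) (Z y) = m * Torus.partialDeriv i (fun y => ρ s (Z y)) y := by
      rw [hDρ s hs y i, ← mul_assoc, mul_inv_cancel₀ hm0.ne', one_mul]
    have E2 : Torus.partialDeriv i (u s) (Z y) = m • Torus.partialDeriv i (fun y => u s (Z y)) y := by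
      rw [hDu s hs y i, smul_smul, mul_inv_cancel₀ hm0.ne', one_smul]
    have E3 : Torus.partialDeriv i (θ s) (Z y) = m * Torus.partialDeriv i (fun y => θ s (Z y)) y := by
      rw [hDθ s hs y i, ← mul_assoc, mul_inv_cancel₀ hm0.ne', one_mul]
    have hmC : m * (C₂ * (κ * r)) = C₂ * κ / 10 := by
      rw [hm]
      field_simp
    refine ⟨?_, ?_, ?_⟩
    · rw [E1, abs_mul, abs_of_pos hm0, ← hmC]
      gcongr
    · rw [E2, norm_smul, Real.norm_of_nonneg hm0.le, ← hmC]
      gcongr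
    · rw [E3, abs_mul, abs_of_pos hm0, ← hmC]
      gcongr
  · push Not at hx
    have hUs : IsOpen {z : T3 | 2 * r + cD * s < Torus.euclidDist z x₀} := ap_isOpen_far x₀ _
    have hxU : x ∈ {z : T3 | 2 * r + cD * s < Torus.euclidDist z x₀} := by
      show 2 * r + cD * s < Torus.euclidDist x x₀
      have : cD * s ≤ cD * t := mul_le_mul_of_nonneg_left hs.2.le hcD
      linarith
    have z1 := ap_partialDeriv_eq_zero_of_isOpen hUs (fun z hz => (hfar s hs z hz).1) i x hxU
    have z2 := ap_partialDeriv_eq_zero_of_isOpen hUs (fun z hz => (hfar s hs z hz).2.2) i x hxU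
    have z3 := ap_partialDeriv_eq_zero_of_isOpen hUs (fun z hz => (hfar s hs z hz).2.1) i x hxU
    rw [z1, z2, z3, abs_zero, norm_zero]
    exact ⟨hb, hb, hb⟩

end Summit.AtomisticToContinuum.HydrodynamicLimit.Theorems.ConeLocalisation.Bubble

end
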